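import Literature.NumberTheory.EllipticCurves.BinaryQuarticResolventTransfer
import Literature.NumberTheory.EllipticCurves.BinaryQuarticReducibleResolventCountProofs
import HarnessLib

/-!
# `Proofs` companion of `BinaryQuarticResolventTransfer`: `φ(f)` is absolutely irreducible unless
# `g_f(X, 1)` has an integer root; the transport through dodqf's absolutely irreducible orbit
# count; `GL₂(ℤ)`-invariance of `W_p^{(2)}(V)` and of the exceptional locus

`Proofs` file (theorems only: no definitions, no named facts), joining
`BinaryQuarticResolventTransfer.lean` (`IsAbsIrreducible`, the transport
`gl2zClassCount_le_of_thue`, `W_p^{(2)}` on both sides) with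
`BinaryQuarticReducibleResolventCountProofs.lean` (forms whose resolvent cubic has an integer
root are `≪_ε T^{4+ε}` in boxes). Source context: M. Bhargava, A. Shankar, *Binary quartic forms
having bounded invariants, and the boundedness of the average rank of elliptic curves*, Ann. of
Math. (2) 181 (2015) 191–242, §2.6 of the published version (Thm 2.19 = [dodqf, Prop. 23] and
the estimate `N(W_p^{(2)}(V); X) = O(X/p²)`), and M. Bhargava, Ann. of Math. 162 (2005), §2.2
p. 1037: the counting function `N(·; X)` of [dodqf] counts *absolutely irreducible* orbits.

* `isAbsIrreducible_ofQuartic_iff_not_exists_int_root`: for irreducible `f`, `φ(f)` is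
  absolutely irreducible iff `g_f(X, 1)` has no integer root (monic cubic: rational roots are
  integers);
  `not_isAbsIrreducible_ofQuartic_x4_add_two_y4`: the example `x⁴ + 2y⁴`;
* `gl2zClassCount_union_le`, `gl2zClassCount_biUnion_le`: (finite) subadditivity of `N(·; X)`;
* `image_gOrbit_ofQuartic_subset_absIrred`: for `f ∈ W_p^{(2)}(V)` irreducible of height `< X`
  with `g_f(X,1)` without integer root, the orbit of `φ(f)` is an absolutely irreducible orbit on
  `W_p^{(2)}(W)` with `0 < |Disc| < 8X/27`;
* `gl2zClassCount_weaklySqDvd_diff_le_absIrred`: hence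
  `N(W_p^{(2)}(V) ∖ {f : g_f has an integer root}; X) ≤ 2·D·B` whenever cubic forms of nonzero
  discriminant represent `1` at most `D` times (Delone–Evertse) and the absolutely irreducible
  orbits on `W_p^{(2)}(W)` with `0 < |Disc| < 8X/27` number at most `B` (the content of
  [dodqf, Prop. 23] in its own counting convention) — to be summed over `p`; the exceptional locus
  is split off once (`gl2zClassCount_le_inter_add`) and is controlled in boxes by
  `card_filter_exists_int_root_resolvent_le`;
* `subst_mem_weaklySqDvd`, `exists_int_root_resolvent_subst_iff`: `W_p^{(2)}(V)` and the
  exceptional locus `{f : g_f(X,1) has an integer root}` are `GL₂(ℤ)`-invariant (so the class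
  counts above are counts of orbits of invariant sets, as `N(S; X)` presupposes in the source:
  `Δ(γ·f) = (det γ)¹²Δ(f)`, perturbations correspond under `γ`, and `g_{γ·f}(X, 1) = g_f(X − u, 1)`
  by `det_twoA1_sub_gram_subst`).

## References

* M. Bhargava, A. Shankar, Ann. of Math. (2) 181 (2015) 191–242, §2.6 (published numbering).
  [cite: BhargavaShankarAnnals2015, §2.6 (Thm 2.19 = dodqf Prop. 23; N(W_p^{(2)}(V);X) = O(X/p²))]
* M. Bhargava, Ann. of Math. (2) 162 (2005) 1031–1063, §2.2 p. 1037, Prop. 23.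
-/

noncomputable section

open Polynomial

namespace Literature.NumberTheory.EllipticCurves

namespace BinaryQuartic

open TernaryPairs

/-- **For irreducible `f`, `φ(f)` is absolutely irreducible iff `g_f(X, 1)` has no integer root**:
the conics of `φ(f)` never have a common rational zero (`not_hasCommonRatZero_ofQuartic`), and a
rational root of the monic integral cubic `g_f(X, 1)` is an integer
(`exists_int_root_resolvent_iff_not_irreducible`). [folklore] -/
theorem isAbsIrreducible_ofQuartic_iff_not_exists_int_root {f : BinaryQuartic ℤ}
    (hf : f.IsIrreducible) :
    IsAbsIrreducible (ofQuartic f) ↔ ¬ ∃ r : ℤ,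
      r ^ 3 + f.c * r ^ 2 + (f.b * f.d - 4 * f.a * f.e) * r
        + (f.a * f.d ^ 2 + f.b ^ 2 * f.e - 4 * f.a * f.c * f.e) = 0 := by
  rw [isAbsIrreducible_ofQuartic_iff, and_iff_right (not_hasCommonRatZero_ofQuartic hf)]
  constructor
  · rintro h ⟨r, hr⟩
    exact h r (by exact_mod_cast hr)
  · intro h t ht
    apply h
    rw [exists_int_root_resolvent_iff_not_irreducible]
    -- `t` is a root of the cubic `g_f(X,1) ∈ ℚ[X]`, which is then reducible
    intro hirr
    set Q : ℚ[X] := (resolventCubic f).toPoly.map (Int.castRingHom ℚ) with hQ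
    have hQeq : Q = (Cubic.map (Int.castRingHom ℚ) (resolventCubic f)).toPoly := by
      rw [hQ, Cubic.map_toPoly]
    have hQdeg : Q.natDegree = 3 := by
      rw [hQeq]
      exact Cubic.natDegree_of_a_ne_zero (by simp [Cubic.map, resolventCubic])
    have hQ0 : Q ≠ 0 := by
      intro h0; rw [h0, natDegree_zero] at hQdeg; exact absurd hQdeg (by norm_num)
    have hroots := (Polynomial.irreducible_iff_roots_eq_zero_of_degree_le_three
      (by omega) (by omega)).mp hirr
    have ht' : t ∈ Q.roots := by
      rw [mem_roots hQ0, IsRoot.def, hQeq]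
      simp only [Cubic.toPoly, Cubic.map, resolventCubic, eq_intCast, map_one, eval_add, eval_mul,
        eval_C, eval_pow, eval_X, one_mul]
      push_cast
      linear_combination ht
    rw [hroots] at ht'
    exact Multiset.notMem_zero _ ht'

/-- **The `D₄` phenomenon is real**: `f = x⁴ + 2y⁴` is irreducible over `ℚ` (Eisenstein), yet
`φ(f)` is not absolutely irreducible — its resolvent cubic `g_f = X³ − 8XY²` vanishes at
`(0 : 1)` (the Jacobian `y² = x³ − 8x` has full rational `2`-torsion). [folklore] -/
theorem not_isAbsIrreducible_ofQuartic_x4_add_two_y4 :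
    ¬ IsAbsIrreducible (ofQuartic (⟨1, 0, 0, 0, 2⟩ : BinaryQuartic ℤ)) := by
  rw [isAbsIrreducible_ofQuartic_iff]
  rintro ⟨-, h⟩
  exact h 0 (by norm_num)

/-- **Subadditivity**: `N(S ∪ S'; X) ≤ N(S; X) + N(S'; X)`. [folklore] -/
theorem gl2zClassCount_union_le (S S' : Set (BinaryQuartic ℤ)) (X : ℝ) :
    gl2zClassCount (S ∪ S') X ≤ gl2zClassCount S X + gl2zClassCount S' X := by
  unfold gl2zClassCount
  have hunion : gl2zOrbit '' {f | f ∈ S ∪ S' ∧ f.IsIrreducible ∧ f.height < X} =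
      gl2zOrbit '' {f | f ∈ S ∧ f.IsIrreducible ∧ f.height < X} ∪
        gl2zOrbit '' {f | f ∈ S' ∧ f.IsIrreducible ∧ f.height < X} := by
    rw [← Set.image_union]
    congr 1
    ext f
    simp only [Set.mem_setOf_eq, Set.mem_union]
    tauto
  rw [hunion]
  exact Set.ncard_union_le _ _

/-- **Finite subadditivity**: `N(⋃_{i ∈ s} Sᵢ; X) ≤ ∑_{i ∈ s} N(Sᵢ; X)` (for the unions
`⋃_{M < p ≤ Y} W_p^{(2)}(V)` of the sieve). [folklore] -/
theorem gl2zClassCount_biUnion_le {ι : Type*} (s : Finset ι) (S : ι → Set (BinaryQuartic ℤ))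
    (X : ℝ) : gl2zClassCount (⋃ i ∈ s, S i) X ≤ ∑ i ∈ s, gl2zClassCount (S i) X := by
  classical
  induction s using Finset.induction_on with
  | empty => simp [gl2zClassCount]
  | insert a s ha ih =>
      rw [Finset.set_biUnion_insert, Finset.sum_insert ha]
      exact (gl2zClassCount_union_le _ _ X).trans (Nat.add_le_add_left ih _)

/-- **Where the orbits lie (absolutely irreducible version)**: for `f ∈ W_p^{(2)}(V)` irreducible
with `H(f) < X` and `g_f(X, 1)` without integer root, the orbit of `φ(f)` is an absolutely
irreducible orbit on `W_p^{(2)}(W)` of nonzero discriminant bounded by `8X/27` — an orbit counted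
by `N(W_p^{(2)}(W); 8X/27)` in the convention of [dodqf]. [cite: BhargavaShankarAnnals2015, Thm 2.19 of the published version (= dodqf Prop. 23)] -/
theorem image_gOrbit_ofQuartic_subset_absIrred (p : ℤ) (X : ℝ) :
    (fun f ↦ gOrbit (ofQuartic f)) ''
        {f | f ∈ (weaklySqDvd p ∩ {f | ¬ ∃ r : ℤ,
            r ^ 3 + f.c * r ^ 2 + (f.b * f.d - 4 * f.a * f.e) * r
              + (f.a * f.d ^ 2 + f.b ^ 2 * f.e - 4 * f.a * f.c * f.e) = 0}) ∧
          f.IsIrreducible ∧ f.height < X} ⊆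
      gOrbit '' {P | P ∈ TernaryPairs.weaklySqDvd p ∧ TernaryPairs.disc P ≠ 0 ∧
        (|TernaryPairs.disc P| : ℝ) < 8 / 27 * X ∧ IsAbsIrreducible P} := by
  rintro _ ⟨f, ⟨⟨hW, hno⟩, hirr, hX⟩, rfl⟩
  refine ⟨ofQuartic f, ⟨ofQuartic_mem_weaklySqDvd hW, ?_, ?_,
    (isAbsIrreducible_ofQuartic_iff_not_exists_int_root hirr).mpr hno⟩, rfl⟩
  · rw [disc_ofQuartic]; exact disc_ne_zero_of_isIrreducible hirr
  · rw [disc_ofQuartic]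
    exact (abs_disc_le_height f).trans_lt (by linarith)

/-- **`N(W_p^{(2)}(V) ∖ {g_f has an integer root}; X) ≤ 2·D·B`** — the transport of the
uniformity estimate through an absolutely irreducible orbit count: if every integral binary cubic
form of nonzero discriminant represents `1` at most `D` times (Delone–Evertse, `D = 12`) and the
absolutely irreducible `GL₂(ℤ) × SL₃(ℤ)`-orbits on `W_p^{(2)}(W)` with `0 < |Disc| < 8X/27` form a
finite set of at most `B` elements ([dodqf, Prop. 23] = Thm 2.19 of the source, in dodqf's own
counting convention: `B = C·X/p²`), then the classes of `W_p^{(2)}(V)` off the exceptional locus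
number at most `2·D·B`. (Sum this over `p`; the exceptional locus is split off once, by
`gl2zClassCount_le_inter_add`, and is negligible by `card_filter_exists_int_root_resolvent_le`.)
[cite: BhargavaShankarAnnals2015, §2.6 of the published version (Thm 2.19 and Prop. 2.16 ⟹ N(W_p^{(2)}(V);X) = O(X/p²))] -/
theorem gl2zClassCount_weaklySqDvd_diff_le_absIrred (p : ℤ) (X : ℝ) (D B : ℕ)
    (hD : ∀ C : Cubic ℤ, C.discr ≠ 0 →
      ∃ T : Finset (ℤ × ℤ), T.card ≤ D ∧ ∀ x y : ℤ, cubicForm C x y = 1 → (x, y) ∈ T)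
    (hfin : (gOrbit '' {P | P ∈ TernaryPairs.weaklySqDvd p ∧ TernaryPairs.disc P ≠ 0 ∧
        (|TernaryPairs.disc P| : ℝ) < 8 / 27 * X ∧ IsAbsIrreducible P}).Finite)
    (hB : (gOrbit '' {P | P ∈ TernaryPairs.weaklySqDvd p ∧ TernaryPairs.disc P ≠ 0 ∧
        (|TernaryPairs.disc P| : ℝ) < 8 / 27 * X ∧ IsAbsIrreducible P}).ncard ≤ B) :
    gl2zClassCount (weaklySqDvd p ∩ {f | ¬ ∃ r : ℤ,
        r ^ 3 + f.c * r ^ 2 + (f.b * f.d - 4 * f.a * f.e) * r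
          + (f.a * f.d ^ 2 + f.b ^ 2 * f.e - 4 * f.a * f.c * f.e) = 0}) X ≤ 2 * D * B := by
  refine (gl2zClassCount_le_of_thue _ X D hD).trans (Nat.mul_le_mul_left _ ?_)
  exact (Set.ncard_le_ncard (image_gOrbit_ofQuartic_subset_absIrred p X) hfin).trans hB

/-- **Splitting off the exceptional locus (once)**: `N(S; X) ≤ N(S ∖ E; X) + N(E; X)` for any
`S` and `E = {f : g_f(X,1) has an integer root}` (or any set `E`). [folklore] -/
theorem gl2zClassCount_le_inter_add (S E : Set (BinaryQuartic ℤ)) (X : ℝ) :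
    gl2zClassCount S X ≤ gl2zClassCount (S ∩ Eᶜ) X + gl2zClassCount E X := by
  have hcover : S ⊆ (S ∩ Eᶜ) ∪ E := by
    intro f hf
    by_cases h : f ∈ E
    · exact Or.inr h
    · exact Or.inl ⟨hf, h⟩
  exact (gl2zClassCount_mono hcover X).trans (gl2zClassCount_union_le _ _ X)

/-! ## `GL₂(ℤ)`-invariance of `W_p^{(2)}(V)` and of the exceptional locus -/

/-- **`W_p^{(2)}(V)` is `GL₂(ℤ)`-invariant**: `Δ(γ · f) = Δ(f)` for `det γ = ±1` (`disc_subst`),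
and the perturbations `γ·f + p g'` are the `γ·(f + p g)` (`g' = γ·g`), so strong divisibility is
invariant too. [cite: BhargavaShankarAnnals2015, §2.6 of the published version (W_p^{(1)}(V), W_p^{(2)}(V) as GL₂(ℤ)-invariant subsets of V_ℤ)] -/
theorem subst_mem_weaklySqDvd {p : ℤ} {f : BinaryQuartic ℤ} (hf : f ∈ weaklySqDvd p)
    {γ : Matrix (Fin 2) (Fin 2) ℤ} (hγ : IsUnit γ.det) : f.subst γ ∈ weaklySqDvd p := by
  have h12 : γ.det ^ 12 = 1 := by
    rcases Int.isUnit_iff.mp hγ with h | h <;> simp [h]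
  refine ⟨by rw [disc_subst, h12, one_mul]; exact hf.1, fun hall ↦ hf.2 fun g ↦ ?_⟩
  have key : (⟨(f.subst γ).a + p * (g.subst γ).a, (f.subst γ).b + p * (g.subst γ).b,
      (f.subst γ).c + p * (g.subst γ).c, (f.subst γ).d + p * (g.subst γ).d,
      (f.subst γ).e + p * (g.subst γ).e⟩ : BinaryQuartic ℤ) =
      (⟨f.a + p * g.a, f.b + p * g.b, f.c + p * g.c, f.d + p * g.d, f.e + p * g.e⟩ :
        BinaryQuartic ℤ).subst γ := by
    ext <;> simp only [subst] <;> ring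
  have := hall (g.subst γ)
  rwa [key, disc_subst, h12, one_mul] at this

/-- `GL₂(ℤ)`-equivalent forms lie in `W_p^{(2)}(V)` together. [folklore] -/
theorem mem_weaklySqDvd_iff_of_gl2zEquiv {p : ℤ} {f f' : BinaryQuartic ℤ} (h : GL2ZEquiv f f') :
    f ∈ weaklySqDvd p ↔ f' ∈ weaklySqDvd p := by
  constructor
  · intro hf
    obtain ⟨γ, hγ, rfl⟩ := h
    exact subst_mem_weaklySqDvd hf hγ
  · intro hf'
    obtain ⟨γ, hγ, rfl⟩ := h.symm
    exact subst_mem_weaklySqDvd hf' hγ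

/-- **The exceptional locus is `GL₂(ℤ)`-invariant**: `g_{γ·f}(X, 1) = g_f(X − u, 1)` with
`u = gramShift f γ` (`det_twoA1_sub_gram_subst`: the resolvent cubics of `f` and `γ · f` differ by
an `F_{ℤ,1}`-translation), so `g_{γ·f}(X,1)` has an integer root iff `g_f(X,1)` does. [folklore] -/
theorem exists_int_root_resolvent_subst_iff (f : BinaryQuartic ℤ) {γ : Matrix (Fin 2) (Fin 2) ℤ}
    (hγ : IsUnit γ.det) :
    (∃ r : ℤ, r ^ 3 + (f.subst γ).c * r ^ 2
        + ((f.subst γ).b * (f.subst γ).d - 4 * (f.subst γ).a * (f.subst γ).e) * r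
        + ((f.subst γ).a * (f.subst γ).d ^ 2 + (f.subst γ).b ^ 2 * (f.subst γ).e
          - 4 * (f.subst γ).a * (f.subst γ).c * (f.subst γ).e) = 0) ↔
      ∃ r : ℤ, r ^ 3 + f.c * r ^ 2 + (f.b * f.d - 4 * f.a * f.e) * r
        + (f.a * f.d ^ 2 + f.b ^ 2 * f.e - 4 * f.a * f.c * f.e) = 0 := by
  have h2 : γ.det ^ 2 = 1 := by
    rcases Int.isUnit_iff.mp hγ with h | h <;> simp [h]
  set u : ℤ := gramShift f γ with hu
  -- `g_{γ·f}(x, 1) = g_f(x − u, 1)`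
  have key : ∀ x : ℤ, x ^ 3 + (f.subst γ).c * x ^ 2
      + ((f.subst γ).b * (f.subst γ).d - 4 * (f.subst γ).a * (f.subst γ).e) * x
      + ((f.subst γ).a * (f.subst γ).d ^ 2 + (f.subst γ).b ^ 2 * (f.subst γ).e
        - 4 * (f.subst γ).a * (f.subst γ).c * (f.subst γ).e)
      = (x - u) ^ 3 + f.c * (x - u) ^ 2 + (f.b * f.d - 4 * f.a * f.e) * (x - u)
        + (f.a * f.d ^ 2 + f.b ^ 2 * f.e - 4 * f.a * f.c * f.e) := by
    intro x
    have e1 := det_twoA1_sub_gram (f.subst γ) x 1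
    have e2 := det_twoA1_sub_gram_subst f h2 x 1
    have e3 := det_twoA1_sub_gram f (x - gramShift f γ * 1) 1
    have e : 2 * (x ^ 3 + (f.subst γ).c * x ^ 2 * 1
        + ((f.subst γ).b * (f.subst γ).d - 4 * (f.subst γ).a * (f.subst γ).e) * x * 1 ^ 2
        + ((f.subst γ).a * (f.subst γ).d ^ 2 + (f.subst γ).b ^ 2 * (f.subst γ).e
          - 4 * (f.subst γ).a * (f.subst γ).c * (f.subst γ).e) * 1 ^ 3)
        = 2 * ((x - gramShift f γ * 1) ^ 3 + f.c * (x - gramShift f γ * 1) ^ 2 * 1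
          + (f.b * f.d - 4 * f.a * f.e) * (x - gramShift f γ * 1) * 1 ^ 2
          + (f.a * f.d ^ 2 + f.b ^ 2 * f.e - 4 * f.a * f.c * f.e) * 1 ^ 3) := by
      rw [← e1, e2, e3]
    have e' := Int.eq_of_mul_eq_mul_left (by norm_num : (2 : ℤ) ≠ 0) e
    rw [hu]
    linear_combination e'
  constructor
  · rintro ⟨r, hr⟩
    exact ⟨r - u, by rw [← key]; exact hr⟩
  · rintro ⟨r, hr⟩
    refine ⟨r + u, ?_⟩
    rw [key, add_sub_cancel_right]
    exact hr

end BinaryQuartic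

end Literature.NumberTheory.EllipticCurves

end
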